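import Mathlib
import HarnessLib
import Summits.HubbardSuperconductivity.HubbardSuperconductivity.Theorems.KLProgrammeKLRegimeCountertermJacksonRemainderCertAnChart
import Summits.HubbardSuperconductivity.HubbardSuperconductivity.Theorems.KLProgrammeKLRegimeCountertermJacksonRemainderCertAnalyticCutoff

/-!
# (C1) ANALYTIC CERTIFICATE at deep scales, part 3 — the FAR-FIELD angular jets (crude, on the tube) and the vanishing alternative

Cell `gate-hubbard-kl`, seat hubbard-kl-k3c3-p3 (g12), `--supports stmt-HubbardSuperconductivity-20437` (stub (C) of `KLRegimeEngineV17F2`),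
located item «(C1)-DEEP-AN».  Off the near square the certificate's rows are multiplied by the far mass `≈ 6.05/((d+1)δ₀)³` of the Jackson
weight, so crude constants suffice — but they must exist.  For a displacement `w` off the grid and the cut (k3c3-p1's a.e. set
`ae_jmeas_offGridSlit`) the displaced angle `certAngle r w = polarAngle ∘ centredRep ∘ (certCurve r − v_w)` is, near the base angle, the polar
angle of a TRANSLATE of the displaced curve (the centring is locally a lattice translation), and:

* §1 a bump-globalisation lemma (a function `C⁴` on a ball agrees near the centre with a global `C⁴` function — so that the lineage's global
  chain rule `abs_iteratedDeriv_comp_le_bell` applies to local charts);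
* §2 `‖D^{l+1}(polarAngle ∘ ofLp)(p)‖ ≤ l!/‖p‖^{l+1}` off the horizontal axis (part 1's isometry argument at `θ = 0`);
* §3 **far-field angular jets**: if the centred displaced base point `P` has `‖P‖ ≥ ρ_f > 0`, then with curve jets `‖(certCurve r)^{(i)}(θ)‖ ≤ D i`:
  `X₁ ≤ D₁/ρ_f`, `X₂ ≤ D₁²/ρ_f² + D₂/ρ_f`, `X₃ ≤ 2D₁³/ρ_f³ + 3D₁D₂/ρ_f² + D₃/ρ_f`, `X₄ ≤ 6D₁⁴/ρ_f⁴ + 12D₁²D₂/ρ_f³ + (3D₂² + 4D₁D₃)/ρ_f² + D₄/ρ_f`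
  (`X_m = certAngleJets r w θ m`);
* §4 **the vanishing alternative**: if `‖P‖ < ρ_f` with `ρ_f² ≤ 4 + μ − 2·klFlatR`, the free band at `P` is below `μ − 2·klFlatR` (`ε(p) ≤ ‖p‖² − 4`),
  so the displaced cutoff vanishes identically near `θ`: `χ_w(θ) = 0` and `∂ⁱχ_w(θ) = 0`.

Pure real analysis; no definitions; nothing about the Hubbard model.
-/

noncomputable section

namespace Summit.HubbardSuperconductivity.HubbardSuperconductivity.Theorems.KLRegimeSplit

set_option linter.dupNamespace false -- summit = problem name (single-conjunct summit), D-0017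

open Real Set Filter Metric Complex
open scoped Topology
open Literature.MathematicalPhysics.QuantumLattice Literature.MathematicalPhysics.QuantumLattice.BandSectorCounting
open Literature.Analysis.SpecialFunctions (contDiffAt_arg_of_mem_slitPlane)
open Summit.HubbardSuperconductivity.HubbardSuperconductivity.Theorems.PerturbedFermiCurve

/-! ## §1 Bump globalisation -/

/-- **A function `Cⁿ` at every point of an open ball agrees, near every point of the half ball, with a GLOBAL `Cⁿ` function.** -/
theorem exists_contDiff_eventuallyEq_of_ball {Φ : Momentum → ℝ} {p₀ : Momentum} {ε : ℝ} (hε : 0 < ε) {n : ℕ}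
    (hΦ : ∀ p : Momentum, ‖p - p₀‖ < ε → ContDiffAt ℝ n Φ p) :
    ∃ F : Momentum → ℝ, ContDiff ℝ n F ∧ ∀ p : Momentum, ‖p - p₀‖ < ε / 2 → F =ᶠ[𝓝 p] Φ := by
  let φ : ContDiffBump p₀ := ⟨ε / 2, 3 * ε / 4, by positivity, by linarith⟩
  refine ⟨fun q => φ q * Φ q, ?_, ?_⟩
  · refine contDiff_iff_contDiffAt.2 fun q => ?_
    by_cases hq : ‖q - p₀‖ < ε
    · exact ((φ.contDiff (n := n)).contDiffAt).mul (hΦ q hq)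
    · have hnot : q ∉ tsupport (φ : Momentum → ℝ) := by
        intro hmem
        rw [φ.tsupport_eq, Metric.mem_closedBall, dist_eq_norm] at hmem
        exact hq (lt_of_le_of_lt hmem (by show 3 * ε / 4 < ε; linarith))
      have hev : (φ : Momentum → ℝ) =ᶠ[𝓝 q] 0 := notMem_tsupport_iff_eventuallyEq.1 hnot
      have hF0 : (fun q => φ q * Φ q) =ᶠ[𝓝 q] fun _ => 0 := by
        filter_upwards [hev] with q' hq'
        simp only [hq', Pi.zero_apply, zero_mul]
      exact contDiffAt_const.congr_of_eventuallyEq hF0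
  · intro p hp
    have hball : Metric.ball p₀ (ε / 2) ∈ 𝓝 p := Metric.isOpen_ball.mem_nhds (by rwa [Metric.mem_ball, dist_eq_norm])
    filter_upwards [hball] with q hq
    have h1 : (φ : Momentum → ℝ) q = 1 := φ.one_of_mem_closedBall (Metric.ball_subset_closedBall hq)
    simp only [h1, one_mul]

/-! ## §2 Derivative norms of the polar angle off the horizontal axis -/

/-- `polarAngle ∘ ofLp` through the isometry of part 1 at `θ = 0`. -/
theorem polarAngle_ofLp_eq_arg (p : Momentum) : polarAngle (WithLp.ofLp p) = 0 + arg (momToComplex (WithLp.ofLp p) * cexp (-((0 : ℝ) : ℂ) * I)) := by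
  simp [polarAngle]

/-- **`‖D^{l+1}(polarAngle ∘ ofLp)(p)‖ ≤ l!/‖p‖^{l+1}` off the horizontal axis** (`p₁ ≠ 0` puts `p₀ + ip₁` in the slit plane). -/
theorem norm_iteratedFDeriv_polarAngle_ofLp_le {p : Momentum} (hp : WithLp.ofLp p 1 ≠ 0) (l : ℕ) :
    ‖iteratedFDeriv ℝ (l + 1) (fun q : Momentum => polarAngle (WithLp.ofLp q)) p‖ ≤ (l.factorial : ℝ) / ‖p‖ ^ (l + 1) := by
  obtain ⟨L, hL⟩ := exists_rotIsometry 0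
  have hL' : ∀ q : Momentum, L q = momToComplex (WithLp.ofLp q) := fun q => by rw [hL]; simp
  have hz : L p ∈ slitPlane := by
    rw [Complex.mem_slitPlane_iff, hL', momToComplex_im]; exact Or.inr hp
  have e : (fun q : Momentum => polarAngle (WithLp.ofLp q)) = arg ∘ L := by funext q; simp [polarAngle, hL']
  rw [e, LinearIsometryEquiv.norm_iteratedFDeriv_comp_right L arg p (l + 1), ← L.norm_map p]
  exact norm_iteratedFDeriv_arg_le hz l

/-! ## §3 Far-field angular jets -/

section Far

variable {r : ℝ → ℝ} (hr : ContDiff ℝ 4 r) {θ : ℝ} {w : ℝ × ℝ}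
  (hgrid : ∀ i : Fin 2, toIocMod Real.two_pi_pos (-Real.pi) (WithLp.ofLp (certCurve r θ - jshift w) i) ≠ -Real.pi + 2 * Real.pi)
  (hslit : toIocMod Real.two_pi_pos (-Real.pi) (WithLp.ofLp (certCurve r θ - jshift w) 1) ≠ 0)
include hr hgrid hslit

/-- **The centring is locally a lattice translation** (k3c3-p1's `contDiffAt_polarAngle_centredRep_of_offGridSlit`, made explicit): off the grid
there is a constant `c` with `certAngle r w ϑ = polarAngle (ofLp (certCurve r ϑ − v_w − c))` for `ϑ` near `θ`, `ofLp (q θ − c) = centredRep (ofLp (q θ))`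
and `(q θ − c)₁ ≠ 0` (`q = certCurve r − v_w`). -/
theorem certAngle_eventuallyEq_translate :
    ∃ c : Momentum, (certAngle r w =ᶠ[𝓝 θ] fun ϑ => polarAngle (WithLp.ofLp (certCurve r ϑ - jshift w - c))) ∧
      WithLp.ofLp (certCurve r θ - jshift w - c) = centredRep (WithLp.ofLp (certCurve r θ - jshift w)) ∧
      WithLp.ofLp (certCurve r θ - jshift w - c) 1 ≠ 0 := by
  set q : ℝ → Momentum := fun ϑ => certCurve r ϑ - jshift w with hqdef
  set z : Fin 2 → ℤ := fun i => toIocDiv Real.two_pi_pos (-Real.pi) (WithLp.ofLp (q θ) i) with hz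
  set c : Momentum := WithLp.toLp 2 fun i => (z i : ℝ) * (2 * Real.pi) with hc
  have hqC : Continuous q := (contDiff_certCurve hr).continuous.sub continuous_const
  -- eventually (in `ϑ`) the centring subtracts the SAME lattice vector
  have hev1 : ∀ i : Fin 2, ∀ᶠ ϑ in 𝓝 θ,
      toIocMod Real.two_pi_pos (-Real.pi) (WithLp.ofLp (q ϑ) i) = WithLp.ofLp (q ϑ) i - (z i : ℝ) * (2 * Real.pi) := by
    intro i
    have hcont : ContinuousAt (fun ϑ => WithLp.ofLp (q ϑ) i) θ :=
      ((continuous_apply i).comp ((PiLp.continuous_ofLp 2 _).comp hqC)).continuousAt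
    have h2 := hcont.eventually (eventually_toIocMod_eq_sub Real.two_pi_pos (-Real.pi) (hgrid i))
    filter_upwards [h2] with ϑ hϑ
    rw [hϑ, zsmul_eq_mul]
  have hevall : ∀ᶠ ϑ in 𝓝 θ, ∀ i : Fin 2,
      toIocMod Real.two_pi_pos (-Real.pi) (WithLp.ofLp (q ϑ) i) = WithLp.ofLp (q ϑ) i - (z i : ℝ) * (2 * Real.pi) :=
    Filter.eventually_all.mpr hev1
  have hcen : ∀ ϑ, (∀ i : Fin 2, toIocMod Real.two_pi_pos (-Real.pi) (WithLp.ofLp (q ϑ) i) = WithLp.ofLp (q ϑ) i - (z i : ℝ) * (2 * Real.pi)) →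
      centredRep (WithLp.ofLp (q ϑ)) = WithLp.ofLp (q ϑ - c) := by
    intro ϑ hϑ
    funext i
    show toIocMod Real.two_pi_pos (-π) (WithLp.ofLp (q ϑ) i) = _
    rw [hϑ i]
    simp [hqdef, hc]
  have hθ := hevall.self_of_nhds
  refine ⟨c, ?_, (hcen θ hθ).symm, ?_⟩
  · filter_upwards [hevall] with ϑ hϑ
    rw [certAngle_apply, hcen ϑ hϑ]
  · rw [← hcen θ hθ]
    exact hslit

/-- **FAR-FIELD ANGULAR JETS.**  If the centred displaced base point `P = centredRep (certCurve r θ − v_w)` has `‖P‖ ≥ ρ_f > 0` then, with curve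
jets `‖(certCurve r)^{(i)}(θ)‖ ≤ D i`:  `X₁ ≤ D₁/ρ_f`, `X₂ ≤ D₁²/ρ_f² + D₂/ρ_f`, `X₃ ≤ 2D₁³/ρ_f³ + 3D₁D₂/ρ_f² + D₃/ρ_f`,
`X₄ ≤ 6D₁⁴/ρ_f⁴ + 12D₁²D₂/ρ_f³ + (3D₂² + 4D₁D₃)/ρ_f² + D₄/ρ_f` (`X = certAngleJets r w θ`). -/
theorem certAngleJets_far_le {ρf : ℝ} (hρf : 0 < ρf)
    (hP : ρf ≤ ‖(WithLp.toLp 2 (centredRep (WithLp.ofLp (certCurve r θ - jshift w))) : Momentum)‖)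
    {D : ℕ → ℝ} (hD : ∀ i, 1 ≤ i → i ≤ 4 → ‖iteratedDeriv i (certCurve r) θ‖ ≤ D i) :
    certAngleJets r w θ 1 ≤ D 1 / ρf ∧
      certAngleJets r w θ 2 ≤ D 1 ^ 2 / ρf ^ 2 + D 2 / ρf ∧
      certAngleJets r w θ 3 ≤ 2 * D 1 ^ 3 / ρf ^ 3 + 3 * D 1 * D 2 / ρf ^ 2 + D 3 / ρf ∧
      certAngleJets r w θ 4 ≤ 6 * D 1 ^ 4 / ρf ^ 4 + 12 * D 1 ^ 2 * D 2 / ρf ^ 3 + (3 * D 2 ^ 2 + 4 * D 1 * D 3) / ρf ^ 2 + D 4 / ρf := by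
  obtain ⟨c, hev, hcen, hne⟩ := certAngle_eventuallyEq_translate hr hgrid hslit
  set pbar : Momentum := certCurve r θ - jshift w - c with hpbar
  have hpn : ρf ≤ ‖pbar‖ := by
    have : pbar = WithLp.toLp 2 (centredRep (WithLp.ofLp (certCurve r θ - jshift w))) := by
      rw [← hcen]
    rw [this]; exact hP
  have hp1 : WithLp.ofLp pbar 1 ≠ 0 := hne
  -- globalise the polar angle around `pbar` (radius `|pbar₁|`: every point of the ball is off the axis)
  set Φ : Momentum → ℝ := fun q => polarAngle (WithLp.ofLp q) with hΦdef
  have hεpos : 0 < |WithLp.ofLp pbar 1| := abs_pos.2 hp1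
  have hΦC : ∀ p : Momentum, ‖p - pbar‖ < |WithLp.ofLp pbar 1| → ContDiffAt ℝ 4 Φ p := by
    intro p hp
    apply contDiffAt_polarAngle_ofLp_of_ne
    intro h0
    have h1 : |WithLp.ofLp (p - pbar) 1| ≤ ‖p - pbar‖ := by
      have := PiLp.norm_apply_le (p - pbar) 1; rwa [Real.norm_eq_abs] at this
    rw [WithLp.ofLp_sub, Pi.sub_apply, h0, zero_sub, abs_neg] at h1
    linarith
  obtain ⟨F, hFC, hFΦ⟩ := exists_contDiff_eventuallyEq_of_ball hεpos hΦC
  -- the translated displaced curve and its jets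
  set γ : ℝ → Momentum := fun ϑ => certCurve r ϑ - jshift w - c with hγdef
  have hγC : ContDiff ℝ 4 γ := ((contDiff_certCurve hr).sub contDiff_const).sub contDiff_const
  have hγθ : γ θ = pbar := rfl
  have hγjets : ∀ i, 1 ≤ i → i ≤ 4 → ‖iteratedDeriv i γ θ‖ ≤ D i := by
    intro i hi1 hi4
    have e : γ = fun ϑ => (-(jshift w + c)) + certCurve r ϑ := by funext ϑ; simp only [hγdef]; abel
    rw [e, iteratedDeriv_const_add (by omega)]; exact hD i hi1 hi4
  -- `certAngle r w = F ∘ γ` near `θ`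
  have hnear : ∀ᶠ ϑ in 𝓝 θ, ‖γ ϑ - pbar‖ < |WithLp.ofLp pbar 1| / 2 := by
    have hcont : ContinuousAt (fun ϑ => ‖γ ϑ - pbar‖) θ := ((hγC.continuous.sub continuous_const).norm).continuousAt
    have h0 : ‖γ θ - pbar‖ < |WithLp.ofLp pbar 1| / 2 := by rw [hγθ, sub_self, norm_zero]; positivity
    exact hcont.eventually (gt_mem_nhds h0)
  have hcomp : certAngle r w =ᶠ[𝓝 θ] F ∘ γ := by
    filter_upwards [hev, hnear] with ϑ h1 h2
    rw [h1, Function.comp_apply]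
    exact ((hFΦ (γ ϑ) h2).self_of_nhds).symm
  -- sizes of `F` at `pbar`: those of the polar angle
  have hM : ∀ k, 1 ≤ k → k ≤ 4 → ‖iteratedFDeriv ℝ k F (γ θ)‖ ≤
      (fun k : ℕ => ((k - 1).factorial : ℝ) / ρf ^ k) k := by
    intro k hk1 _
    rw [hγθ, ((hFΦ pbar (by rw [sub_self, norm_zero]; positivity)).iteratedFDeriv ℝ k).eq_of_nhds]
    obtain ⟨l, rfl⟩ : ∃ l, k = l + 1 := ⟨k - 1, by omega⟩
    simp only [Nat.add_sub_cancel]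
    calc ‖iteratedFDeriv ℝ (l + 1) Φ pbar‖ ≤ (l.factorial : ℝ) / ‖pbar‖ ^ (l + 1) := norm_iteratedFDeriv_polarAngle_ofLp_le hp1 l
      _ ≤ (l.factorial : ℝ) / ρf ^ (l + 1) := by
          apply div_le_div_of_nonneg_left (by positivity) (by positivity)
          exact pow_le_pow_left₀ hρf.le hpn _
  obtain ⟨b1, b2, b3, b4⟩ := abs_iteratedDeriv_comp_le_bell hFC hγC hM hγjets
  simp only [Nat.factorial, Nat.succ_eq_add_one, Nat.cast_one, Nat.cast_mul, zero_add, mul_one, Nat.reduceSub,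
    Nat.sub_self, pow_one] at b1 b2 b3 b4
  have e1 : ∀ m, certAngleJets r w θ m = |iteratedDeriv m (F ∘ γ) θ| := fun m => by
    show |iteratedDeriv m (certAngle r w) θ| = _
    rw [Filter.EventuallyEq.iteratedDeriv_eq m hcomp]
  rw [e1 1, e1 2, e1 3, e1 4]
  refine ⟨b1.trans (le_of_eq ?_), b2.trans (le_of_eq ?_), b3.trans (le_of_eq ?_), b4.trans (le_of_eq ?_)⟩
  · ring
  · ring
  · push_cast; ring
  · push_cast; ring

end Far

/-! ## §4 The vanishing alternative: a centred displaced point close to the origin is outside the doubled tube -/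

/-- `ε(p) ≤ p₀² + p₁² − 4` (from `cos x ≥ 1 − x²/2`). -/
theorem freeBandFn_le_normSq_sub_four (p : Fin 2 → ℝ) : freeBandFn p ≤ p 0 ^ 2 + p 1 ^ 2 - 4 := by
  have h0 := Real.one_sub_sq_div_two_le_cos (x := p 0)
  have h1 := Real.one_sub_sq_div_two_le_cos (x := p 1)
  simp only [freeBandFn]
  nlinarith

/-- The Euclidean norm of a planar point: `‖toLp 2 p‖² = p₀² + p₁²`. -/
theorem norm_toLp_sq (p : Fin 2 → ℝ) : ‖(WithLp.toLp 2 p : Momentum)‖ ^ 2 = p 0 ^ 2 + p 1 ^ 2 := by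
  rw [EuclideanSpace.norm_eq, Real.sq_sqrt (by positivity), Fin.sum_univ_two]
  simp [sq_abs]

/-- **THE VANISHING ALTERNATIVE.**  If the centred displaced base point has norm `< ρ_f` with `ρ_f² ≤ 4 + μ − 2·klFlatR`, the displaced cutoff
vanishes identically near `θ`: `χ_w(θ) = 0` and `∂ⁱχ_w(θ) = 0` for every `i`. -/
theorem certCutoff_jets_eq_zero_of_norm_lt {r : ℝ → ℝ} (hr : ContDiff ℝ 4 r) {θ μ ρf : ℝ} {w : ℝ × ℝ}
    (hρf : ρf ^ 2 ≤ 4 + μ - 2 * klFlatR)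
    (hP : ‖(WithLp.toLp 2 (centredRep (WithLp.ofLp (certCurve r θ - jshift w))) : Momentum)‖ < ρf) (i : ℕ) :
    iteratedDeriv i (certCutoff μ r w) θ = 0 := by
  set q : ℝ → Momentum := fun ϑ => certCurve r ϑ - jshift w with hqdef
  -- at `θ`: the band value is strictly below `μ − 2·klFlatR`
  have hlt : freeBandFn (WithLp.ofLp (q θ)) - μ < -(2 * klFlatR) := by
    have hc : freeBandFn (centredRep (WithLp.ofLp (q θ))) = freeBandFn (WithLp.ofLp (q θ)) := sqDispersion_centred _
    have h1 := freeBandFn_le_normSq_sub_four (centredRep (WithLp.ofLp (q θ)))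
    rw [← norm_toLp_sq] at h1
    have h2 : ‖(WithLp.toLp 2 (centredRep (WithLp.ofLp (q θ))) : Momentum)‖ ^ 2 < ρf ^ 2 :=
      pow_lt_pow_left₀ hP (norm_nonneg _) two_ne_zero
    rw [← hc]; linarith
  -- hence near `θ`: `2·klFlatR ≤ |ε(q ϑ) − μ|`, i.e. the cutoff vanishes
  have hqC : Continuous q := (contDiff_certCurve hr).continuous.sub continuous_const
  have hcont : Continuous fun ϑ => freeBandFn (WithLp.ofLp (q ϑ)) - μ := by
    have hε : Continuous freeBandFn := by unfold freeBandFn; fun_prop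
    exact (hε.comp ((PiLp.continuous_ofLp 2 _).comp hqC)).sub continuous_const
  have hev : ∀ᶠ ϑ in 𝓝 θ, freeBandFn (WithLp.ofLp (q ϑ)) - μ < -(2 * klFlatR) := hcont.continuousAt.eventually (gt_mem_nhds hlt)
  have hzero : certCutoff μ r w =ᶠ[𝓝 θ] fun _ => (0 : ℝ) := by
    filter_upwards [hev] with ϑ hϑ
    rw [certCutoff_apply]
    apply klFlatCutoffFn_eq_zero_of_le_abs
    rw [abs_of_neg (by linarith [klFlatR_pos])]; linarith
  rw [Filter.EventuallyEq.iteratedDeriv_eq i hzero, iteratedDeriv_const]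
  split <;> rfl

end Summit.HubbardSuperconductivity.HubbardSuperconductivity.Theorems.KLRegimeSplit

end
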